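import Mathlib.Topology.Algebra.Category.ProfiniteGrp.Completion
import HarnessLib

/-!
# Torsion of the profinite completion of a commutative group comes from the group

Topic `Literature/GroupTheory`.  For a commutative group `A` write `Â` for its profinite completion
(Mathlib `ProfiniteGrp.ProfiniteCompletion.completion`, the limit of the finite quotients `A/N` over the
finite-index subgroups `N`; Ribes–Zalesskii, *Profinite Groups*, §3.2) and `η : A → Â` for the canonical
map.  Fix `n : ℕ` and assume

* `[A : Aⁿ] < ∞` (the subgroup of `n`-th powers has finite index), and
* `A[n] = {a | aⁿ = 1}` is finite.

**Theorem** (`exists_eta_eq_of_pow_eq_one`): every `x ∈ Â` with `xⁿ = 1` is `η(a)` for some `a ∈ A[n]`;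
equivalently `Â[n] = η(A[n])` (`mem_map_eta_of_pow_eq_one`).  (Example: `A = K^×` for a `p`-adic local field
`K`, `n = 2`: the `2`-torsion of `(K^×)^∧` is `{±1}` — the abc-iut cell's (μtor) input of [EtTh] Thm. 1.10 (iii),
file `AnabelianGeometry/EtaleTheta/GalSectKxHatTorsion.lean`.)

Proof.  For a finite-index `N ≤ A` put `S(N) := {a ∈ A[n] | a ≡ x_N (mod N)}`.  (i) `S(N) ≠ ∅`: the
subgroup `M := N ∩ Nⁿ` has finite index (`[A : Nⁿ] ≤ [A : N]·[A : Aⁿ]`); if `x_M = b M` then `bⁿ ∈ M ⊆ Nⁿ`,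
say `bⁿ = cⁿ` with `c ∈ N`, and `a := b c⁻¹ ∈ A[n]` satisfies `a ≡ b ≡ x_N (mod N)`.  (ii) `S` is monotone
(`M ≤ N ⇒ S(M) ⊆ S(N)`) by the compatibility of `x`.  (iii) The `S(N)` are subsets of the FINITE set `A[n]`:
choose `N₀` with `S(N₀)` of minimal cardinality; for any `N`, `S(N₀ ∩ N) ⊆ S(N₀)` has cardinality
`≥ |S(N₀)|`, so `S(N₀ ∩ N) = S(N₀)` and `S(N₀) ⊆ S(N)`.  Any `a ∈ S(N₀)` then satisfies `η(a) = x`.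

Mathlib-only; theorems only (no definitions, no named facts, no `sorry`).  Elementary; recorded for
the abc-iut cell (seat abc-iut-w5-d062), nothing here bears on [IUTchIII] Cor. 3.12.

## References
* L. Ribes, P. Zalesskii, *Profinite Groups*, 2nd ed., Springer 2010, §3.2. [RibesZalesskii2010]
-/

namespace Literature.GroupTheory

open CategoryTheory ProfiniteGrp ProfiniteGrp.ProfiniteCompletion

universe u

namespace ProfiniteCompletionTorsion

variable {A : Type u} [CommGroup A]

/-- If `Aⁿ` has finite index in the commutative group `A`, then so does `Nⁿ` for every finite-index
subgroup `N` (`[A : Nⁿ] = [A : N·A[n]] · [A : Aⁿ]`). [cite: RibesZalesskii2010, §3.2] -/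
theorem finiteIndex_map_powMonoidHom {n : ℕ} (hfin : ((powMonoidHom n : A →* A).range).FiniteIndex)
    (N : Subgroup A) [N.FiniteIndex] : (N.map (powMonoidHom n : A →* A)).FiniteIndex := by
  haveI : (N ⊔ (powMonoidHom n : A →* A).ker).FiniteIndex := Subgroup.finiteIndex_of_le le_sup_left
  refine ⟨?_⟩
  rw [Subgroup.index_map]
  exact mul_ne_zero Subgroup.FiniteIndex.index_ne_zero hfin.index_ne_zero

/-- The `N`-component of `η(a)` is the class of `a`. [cite: RibesZalesskii2010, §3.2] -/
theorem etaFn_val (a : A) (N : FiniteIndexNormalSubgroup A) :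
    (etaFn (GrpCat.of A) a).val N = (QuotientGroup.mk a : A ⧸ N.toSubgroup) := rfl

/-- Compatibility of the components of `x ∈ Â` along `M ≤ N`, on representatives: if `x_M = b M` then
`x_N = b N`. [cite: RibesZalesskii2010, §3.2] -/
theorem val_eq_mk_of_le (x : completion (GrpCat.of A)) {M N : FiniteIndexNormalSubgroup A} (h : M ≤ N)
    {b : A} (hb : x.val M = (QuotientGroup.mk b : A ⧸ M.toSubgroup)) :
    x.val N = (QuotientGroup.mk b : A ⧸ N.toSubgroup) := by
  rw [← x.prop h.hom, hb]
  rfl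

/-- The `N`-component of a power is the power of the `N`-component. [cite: RibesZalesskii2010, §3.2] -/
theorem val_pow (x : completion (GrpCat.of A)) (n : ℕ) (N : FiniteIndexNormalSubgroup A) :
    (x ^ n).val N = (x.val N) ^ n := rfl

/-- **Step (i).**  For `x ∈ Â` with `xⁿ = 1` and every finite-index `N`, some `a ∈ A[n]` represents the
`N`-component of `x` (refine to `M = N ∩ Nⁿ`). [cite: RibesZalesskii2010, §3.2] -/
theorem exists_torsion_rep {n : ℕ} (hfin : ((powMonoidHom n : A →* A).range).FiniteIndex)
    (x : completion (GrpCat.of A)) (hx : x ^ n = 1) (N : FiniteIndexNormalSubgroup A) :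
    ∃ a : A, a ^ n = 1 ∧ x.val N = (QuotientGroup.mk a : A ⧸ N.toSubgroup) := by
  haveI : (N.toSubgroup.map (powMonoidHom n : A →* A)).FiniteIndex :=
    finiteIndex_map_powMonoidHom hfin N.toSubgroup
  let M : FiniteIndexNormalSubgroup A :=
    { toSubgroup := N.toSubgroup ⊓ N.toSubgroup.map (powMonoidHom n : A →* A) }
  have hMN : M ≤ N := fun _ ha => (Subgroup.mem_inf.mp ha).1
  obtain ⟨b, hb⟩ := QuotientGroup.mk'_surjective M.toSubgroup (x.val M)
  rw [QuotientGroup.mk'_apply] at hb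
  -- `bⁿ ∈ M`
  have hbn : b ^ n ∈ M.toSubgroup := by
    rw [← QuotientGroup.eq_one_iff, QuotientGroup.mk_pow, hb]
    change (x ^ n).val M = 1
    rw [hx]
    rfl
  obtain ⟨c, hcN, hc⟩ := Subgroup.mem_map.mp (Subgroup.mem_inf.mp hbn).2
  refine ⟨b * c⁻¹, ?_, ?_⟩
  · rw [mul_pow, inv_pow, ← show c ^ n = b ^ n from hc, mul_inv_cancel]
  · rw [val_eq_mk_of_le x hMN hb.symm, QuotientGroup.mk_mul, QuotientGroup.mk_inv,
      (QuotientGroup.eq_one_iff c).mpr hcN, inv_one, mul_one]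

/-- **Torsion of `Â` comes from torsion of `A`.**  If `[A : Aⁿ] < ∞` and `A[n]` is finite, every `x ∈ Â`
with `xⁿ = 1` is `η(a)` for some `a ∈ A` with `aⁿ = 1`. [cite: RibesZalesskii2010, §3.2] -/
theorem exists_eta_eq_of_pow_eq_one {n : ℕ} (hfin : ((powMonoidHom n : A →* A).range).FiniteIndex)
    (htors : {a : A | a ^ n = 1}.Finite) (x : completion (GrpCat.of A)) (hx : x ^ n = 1) :
    ∃ a : A, a ^ n = 1 ∧ etaFn (GrpCat.of A) a = x := by
  classical
  -- the fibres `S N ⊆ A[n]`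
  let S : FiniteIndexNormalSubgroup A → Set A := fun N =>
    {a : A | a ^ n = 1 ∧ x.val N = (QuotientGroup.mk a : A ⧸ N.toSubgroup)}
  have hS_fin : ∀ N, (S N).Finite := fun N => htors.subset fun a ha => ha.1
  have hS_anti : ∀ {M N : FiniteIndexNormalSubgroup A}, M ≤ N → S M ⊆ S N :=
    fun h a ha => ⟨ha.1, val_eq_mk_of_le x h ha.2⟩
  have hS_ne : ∀ N, (S N).Nonempty := fun N => by
    obtain ⟨a, ha, hrep⟩ := exists_torsion_rep hfin x hx N
    exact ⟨a, ha, hrep⟩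
  -- a fibre of minimal cardinality
  have hex : ∃ k, ∃ N : FiniteIndexNormalSubgroup A, (hS_fin N).toFinset.card = k :=
    ⟨_, { toSubgroup := ⊤ }, rfl⟩
  obtain ⟨N₀, hN₀⟩ := Nat.find_spec hex
  have hmin : ∀ N : FiniteIndexNormalSubgroup A,
      (hS_fin N₀).toFinset.card ≤ (hS_fin N).toFinset.card := fun N => by
    rw [hN₀]
    exact Nat.find_min' hex ⟨N, rfl⟩
  -- `S N₀ ⊆ S N` for every `N`
  have hsub : ∀ N, S N₀ ⊆ S N := fun N => by
    have h1 : S (N₀ ⊓ N) ⊆ S N₀ := hS_anti inf_le_left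
    have h2 : S (N₀ ⊓ N) = S N₀ := by
      have hfs : (hS_fin (N₀ ⊓ N)).toFinset ⊆ (hS_fin N₀).toFinset :=
        Set.Finite.toFinset_subset_toFinset.mpr h1
      exact Set.Finite.toFinset_inj.mp (Finset.eq_of_subset_of_card_le hfs (hmin (N₀ ⊓ N)))
    exact h2 ▸ hS_anti inf_le_right
  obtain ⟨a, ha⟩ := hS_ne N₀
  refine ⟨a, ha.1, ProfiniteGrp.limit_ext _ _ _ fun N => ?_⟩
  rw [etaFn_val]
  exact ((hsub N) ha).2.symm

/-- Subgroup form: the `n`-torsion of `Â` lies in (hence equals) the image of `A[n]` under `η`.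
[cite: RibesZalesskii2010, §3.2] -/
theorem mem_map_eta_of_pow_eq_one {n : ℕ} (hfin : ((powMonoidHom n : A →* A).range).FiniteIndex)
    (htors : {a : A | a ^ n = 1}.Finite) (T : Subgroup A) (hT : ∀ a : A, a ^ n = 1 → a ∈ T)
    (x : completion (GrpCat.of A)) (hx : x ^ n = 1) :
    x ∈ T.map (eta (GrpCat.of A)).hom := by
  obtain ⟨a, ha, rfl⟩ := exists_eta_eq_of_pow_eq_one hfin htors x hx
  exact ⟨a, hT a ha, rfl⟩

end ProfiniteCompletionTorsion

end Literature.GroupTheory
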